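import Literature.MathematicalPhysics.QuantumFieldTheory.MullerSchiemann1987.MS87Theorem3ExtensionsR4
import HarnessLib

/-!
# Müller–Schiemann, *Continuum limit of a hierarchical SU(2) lattice gauge theory in 4 dimensions*
# (CMP 110, 1987), p.268 (3.9)–(3.11): THE REDUCTION OF THE GAUGE-MODEL RECURSION (3.8) TO (3.1),
# `𝒯₍₄₎ g̃ = {𝒯₍₂₎[𝒯₍₂₎ g̃]^{1/2}}²` — PROVED on the group (any compact Hausdorff group) and for the analytically
# continued transforms on `SU(2)` (theorems only; no definition, no named fact)

statement-level skeleton of published theorems with citation tags; proofs where landed; nothing here is a claim about the Yang–Mills mass gap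

**Citation header (reproduction of PUBLISHED work).** V. F. Müller, J. Schiemann, *Continuum limit of a hierarchical
SU(2) lattice gauge theory in 4 dimensions*, Commun. Math. Phys. **110** (1987) 261–286, doi 10.1007/BF01207367
[MullerSchiemann1987]; (1.1) p.262, (2.4) p.263, (2.6) p.264, (3.1) p.266, (3.8) p.267, p.268 L.1–13 with
(3.9)–(3.11), (5.3) p.275 (held Project Euclid scan `paper:url-96df5da18d4c`; displays read by this seat on its own 3×
page renders `run/shared/lean/pub/lit-balaban/lit-balaban-p12/renders-cmp110ms/ms87-cmp110-pdfp007,008-journalp267,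
268-x3.png`). Lean lane of the lit-balaban YM LIT SWEEP CONTEXT row X1 (register level; zero weight for any token of
that table); the model is the `d = 4` HIERARCHICAL `SU(2)` gauge model, NOT lattice Yang–Mills.

**What the paper prints (p.268 L.1–13).** *«We can reduce its analysis [(3.8)] to the preceding one. … Defining now
[𝒯₍₂₎g̃]^{1/2}(u, z) = ∫dv g̃(uv⁻¹, z/2) g̃(v, z/2) / ∫dv[g̃(v, 0)]², (3.9) 𝒯₍₂₎g̃ = {[𝒯₍₂₎g̃]^{1/2}}², (3.10)
and writing for g̃′ defined by (3.8) g̃′(u, z) = (𝒯₍₄₎g̃)(u, z), we have 𝒯₍₄₎g̃ = {𝒯₍₂₎[𝒯₍₂₎g̃]^{1/2}}² (3.11)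
connecting the recursion relations (3.8) and (3.1). It remains to trace the domains.»*; (3.8) p.267:
*«g̃′(u, z) = (1/𝒩){∫dv₁dv₂dv₃ g̃(uv₁⁻¹, z/4) g̃(v₁v₂⁻¹, z/4) g̃(v₂v₃⁻¹, z/4) g̃(v₃, z/4)}⁴»*; (1.1) p.262:
*«(𝒯g)(u) = {g^{*r}(u)/g^{*r}(e₀)}^r»*.

**What this file proves (kernel-checked, 0 sorry, standard axioms; no definition, no named fact).** `𝒯_r`, `g^{*n}`,
`𝒢` are the sibling `MS87MigdalRecursion`'s `Migdal.migdal r`, `Migdal.convPow`, `Migdal.InG`; `⋆` is the tree's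
`QuantumLattice.haarConv` for the Haar probability measure `haarProbability G`; on `SU(2)`, `u₀, u₃, e^{−ixσ₃}` are
`HeatKernel.u0/u3/diagPhase`, the ellipse `𝒟(d)` and the strips are written out, and the extension (6.21) is
`g̃_H(w, ζ) = H(u₀(w) cos ζ + u₃(w) sin ζ)`.
* §1 ON THE GROUP (zero angle; any compact Hausdorff group `G`): `(k/a) ⋆ (f/b) = (k ⋆ f)/(ab)` (`haarConv_div_div`);
  **(3.9) at `z = 0`**: `[𝒯₂g]^{1/2} := (g ⋆ g)/(g ⋆ g)(e₀)`, the denominator being `∫[g(v)]² dv = ∫dv[g̃(v,0)]²` for a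
  symmetric `g` (the sibling's `haarConv_self_apply_one`); `[𝒯₂g]^{1/2} ∈ 𝒢` for `g ∈ 𝒢` (`inG_sqrtT2`), central and
  symmetric when `g` is (`isCentral_sqrtT2`, `isSymm_sqrtT2`); **(3.10)** `𝒯₂ g = {[𝒯₂g]^{1/2}}²` (`eq310`, = (1.1));
  `g^{*4} = (g ⋆ g) ⋆ (g ⋆ g)` (`convPow_three_eq`, the tree's associativity `haarConv_haarConv`); and **(3.11) ON THE
  GROUP**: `𝒯₄ g = {𝒯₂[𝒯₂g]^{1/2}}²` pointwise, for continuous `g` with `(g ⋆ g)(e₀) ≠ 0` (`eq311`), in particular on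
  `𝒢` (`eq311_inG`).
* §2 REAL SLICES ON `SU(2)` (generic): if `B(w, s) = f(e^{−isσ₃}w)` for real `s` with `f` a class function, then
  `∫dv B(uv⁻¹, s/2) B(v, s/2) = (f ⋆ f)(e^{−isσ₃}u)` (`conv_real_slice`, the sibling's `haarConv_sq_mul`),
  `∫dv [B(v, 0)]² = (f ⋆ f)(e₀)` for symmetric `f` (`normsq_real_slice`), hence **(3.9)–(3.10) on the real slice**:
  `[𝒯₍₂₎B]^{1/2}(w, s) = [𝒯₂f]^{1/2}(e^{−isσ₃}w)` (`sqrtT2_real_slice`) and `(𝒯₍₂₎B)(u, t) = 𝒯₂f(e^{−itσ₃}u)`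
  (`T2_real_slice`, (2.4)).
* §3 **(3.11) FOR THE CONTINUED TRANSFORMS ON `SU(2)`** (`eq311_continued`): for `g = H(u₀) ∈ 𝒢` with `H` holomorphic
  on `𝒟(d)`, `d > 0`, the continued (3.8) `(𝒯₍₄₎g̃_H)(u, z) = {brace/g^{*4}(e₀)}⁴` (the sibling
  `MS87Theorem3ExtensionsR4`) and `{𝒯₍₂₎[𝒯₍₂₎g̃_H]^{1/2}}²(u, z)` with (3.9)'s `[𝒯₍₂₎g̃_H]^{1/2}(w, ζ) =
  ∫dv g̃_H(wv⁻¹, ζ/2) g̃_H(v, ζ/2)/∫dv[g̃_H(v,0)]²` AGREE on the strip `{|Im z| < 4d}` — both sides are holomorphic there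
  (siblings `differentiableOn_eq38`, `differentiableOn_J`/`differentiableOn_eq31`) and agree for real `z = t` by §1–§2
  (identity theorem on the strip, the tree's `eqOn_setOf_abs_im_lt_of_forall_ofReal`).

**Readings / scope (declared).** (i) (3.11) is proved on the group for any compact Hausdorff `G` and continuous `g`
with `(g ⋆ g)(e₀) ≠ 0`; for the continued transforms it is proved on `SU(2)` for extensions of the form (6.21) (the
form in which Theorem 3 produces them; for Sect. 3's general (A₁) functions the real slice is `g(e^{−ixσ₃}u)` by
(2.8)/(3.6), the same mechanism), on the strip where (3.8) is continued — not as an identity of entire functions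
(which follows scale by scale from the sibling's tower and is not restated). (ii) The paper's triple integral is the
iterated integral of the sibling's `eq38_real`/`differentiableOn_brace38`. (iii) «It remains to trace the domains»
((3.12)–(3.14)) and the Corollary (3.15) are the sibling `MS87RecursionCoefficients`'s business, not this file's.

**Not claimed.** Theorem 1, its Corollary, (3.12)–(3.15); anything about lattice Yang–Mills or the Clay problem.
-/

noncomputable section

open Filter Set Metric Function Complex MeasureTheory
open scoped Topology Real

namespace Literature.MathematicalPhysics.QuantumFieldTheory

namespace MullerSchiemann1987

namespace ReductionT4T2

open Literature.MathematicalPhysics.QuantumLattice (haarConv haarConv_apply haarConv_haarConv)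
open Literature.Analysis.Complex (isOpen_setOf_abs_im_lt eqOn_setOf_abs_im_lt_of_forall_ofReal)
open HeatKernel (u0 u3 diagPhase diagPhase_add diagPhase_zero)
open Migdal (InG migdal IsCentral IsSymm convPow migdal_two migdal_four continuous_convPow isCentral_haarConv
  isSymm_haarConv haarConv_nonneg convPow_apply_one_pos haarConv_self_apply_one haarConv_sq_mul)
open MigdalStripWidening (differentiableOn_J continuousOn_J differentiableOn_eq31)
open Theorem3Continuation (differentiableOn_eq621 continuousOn_eq621 eq621_at_zero)
open Theorem3Extensions (eq621_real_slice isSymm_of_eq_H_u0)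
open Theorem3ExtensionsR4 (differentiableOn_eq38 brace38_real_slice)

/-! ## §1 (3.9)–(3.11) on the group (zero angle) -/

section General

variable {G : Type*} [Group G] [TopologicalSpace G] [IsTopologicalGroup G] [CompactSpace G]
  [MeasurableSpace G] [BorelSpace G]

/-- Scaling both factors of a Haar convolution by constants: `(k/a) ⋆ (f/b) = (k ⋆ f)/(ab)` — the normalisations of
(3.9)–(3.11) factor out of the convolutions. [cite: MullerSchiemann1987, (3.9)–(3.11) p.268] -/
theorem haarConv_div_div (k f : G → ℝ) (a b : ℝ) (u : G) :
    haarConv (fun v => k v / a) (fun v => f v / b) u = haarConv k f u / (a * b) := by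
  simp only [haarConv_apply]
  rw [← integral_div]
  refine integral_congr_ae (Eventually.of_forall fun h => ?_)
  ring

/-- **(3.9) at zero angle lies in `𝒢`**: for `g ∈ 𝒢`, `[𝒯₂g]^{1/2} := (g ⋆ g)/(g ⋆ g)(e₀)` is continuous, central,
`≥ 0` and `= 1` at `e₀`. [cite: MullerSchiemann1987, (3.9) p.268, p.283 L.27–28] -/
theorem inG_sqrtT2 {g : G → ℝ} (hg : InG g) : InG (fun u => haarConv g g u / haarConv g g 1) where
  continuous := (continuous_convPow hg.continuous 1).div_const _
  central := fun u v => by simp only [isCentral_haarConv hg.central hg.central u v]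
  nonneg := fun u => div_nonneg (haarConv_nonneg hg.nonneg hg.nonneg u) (convPow_apply_one_pos hg 1).le
  apply_one := div_self (convPow_apply_one_pos hg 1).ne'

/-- `[𝒯₂g]^{1/2}` is a class function when `g` is ((2.2) iterates). [cite: MullerSchiemann1987, (3.9) p.268, (2.2)
p.263] -/
theorem isCentral_sqrtT2 {g : G → ℝ} (hg : IsCentral g) : IsCentral (fun u => haarConv g g u / haarConv g g 1) :=
  fun u v => by simp only [isCentral_haarConv hg hg u v]

/-- `[𝒯₂g]^{1/2}` is symmetric when `g` is central and symmetric ((2.3) iterates). [cite: MullerSchiemann1987, (3.9)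
p.268, (2.3) p.263] -/
theorem isSymm_sqrtT2 {g : G → ℝ} (hg : IsCentral g) (hs : IsSymm g) :
    IsSymm (fun u => haarConv g g u / haarConv g g 1) :=
  fun u => by simp only [isSymm_haarConv hg hs hs u]

/-- **(3.10) at zero angle**: `𝒯₂ g = {[𝒯₂g]^{1/2}}²` — this is (1.1) for `r = 2`; for symmetric `g` the denominator
`(g ⋆ g)(e₀)` of `[𝒯₂g]^{1/2}` is `∫[g(v)]² dv = ∫dv[g̃(v, 0)]²` of (3.9) (the sibling's `haarConv_self_apply_one`).
[cite: MullerSchiemann1987, (3.9)–(3.10) p.268, (1.1) p.262] -/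
theorem eq310 (g : G → ℝ) (u : G) :
    migdal 2 g u = (fun w => haarConv g g w / haarConv g g 1) u ^ 2 :=
  migdal_two g u

/-- `g^{*4} = (g ⋆ g) ⋆ (g ⋆ g)` for continuous `g` (associativity of the Haar convolution, the tree's
`haarConv_haarConv`). [cite: MullerSchiemann1987, (3.11) p.268, (1.1) p.262] -/
theorem convPow_three_eq [T2Space G] {g : G → ℝ} (hg : Continuous g) :
    convPow g 3 = haarConv (haarConv g g) (haarConv g g) := by
  show haarConv g (haarConv g (haarConv g g)) = _
  exact haarConv_haarConv hg hg (continuous_convPow hg 1)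

/-- **(3.11) ON THE GROUP**: `𝒯₄ g = {𝒯₂[𝒯₂g]^{1/2}}²` pointwise, for continuous `g` with `(g ⋆ g)(e₀) ≠ 0` — the
normalisations `(g ⋆ g)(e₀)²` cancel in `𝒯₂` and `([𝒯₂g]^{1/2})^{*2} = g^{*4}/(g ⋆ g)(e₀)²` by associativity.
[cite: MullerSchiemann1987, (3.11) p.268] -/
theorem eq311 [T2Space G] {g : G → ℝ} (hg : Continuous g) (hM : haarConv g g 1 ≠ 0) (u : G) :
    migdal 4 g u = migdal 2 (fun w => haarConv g g w / haarConv g g 1) u ^ 2 := by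
  rw [migdal_four, migdal_two, haarConv_div_div, haarConv_div_div, convPow_three_eq hg,
    div_div_div_cancel_right₀ (mul_ne_zero hM hM)]
  ring

/-- **(3.11) on `𝒢`**: for `g ∈ 𝒢`, `𝒯₄ g = {𝒯₂[𝒯₂g]^{1/2}}²` (the denominator `(g ⋆ g)(e₀)` is positive on `𝒢`).
[cite: MullerSchiemann1987, (3.11) p.268, p.283 L.27–28] -/
theorem eq311_inG [T2Space G] {g : G → ℝ} (hg : InG g) :
    migdal 4 g = fun u => migdal 2 (fun w => haarConv g g w / haarConv g g 1) u ^ 2 :=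
  funext fun u => eq311 hg.continuous (convPow_apply_one_pos hg 1).ne' u

end General

/-! ## §2 Real slices on `SU(2)`: (3.9)–(3.10) at a real angle -/

/-- **The real slice of the continued convolution**: if `B(w, s) = f(e^{−isσ₃}w)` for real `s` ((2.6)) with `f` a
class function, then `∫dv B(uv⁻¹, s/2) B(v, s/2) = (f ⋆ f)(e^{−isσ₃}u)` (the sibling's substitution `haarConv_sq_mul`
with `a = e^{−(i/2)sσ₃}`). [cite: MullerSchiemann1987, (3.9) p.268, (2.4) p.263, (2.6) p.264] -/
theorem conv_real_slice {B : (Matrix.specialUnitaryGroup (Fin 2) ℂ) → ℂ → ℂ}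
    {f : (Matrix.specialUnitaryGroup (Fin 2) ℂ) → ℝ}
    (hB : ∀ (W : (Matrix.specialUnitaryGroup (Fin 2) ℂ)) (s : ℝ), B W (s : ℂ) = (f (diagPhase s * W) : ℂ))
    (hc : IsCentral f) (U : (Matrix.specialUnitaryGroup (Fin 2) ℂ)) (s : ℝ) :
    ∫ V, B (U * V⁻¹) ((s : ℂ) / 2) * B V ((s : ℂ) / 2) ∂(haarProbability (Matrix.specialUnitaryGroup (Fin 2) ℂ)) =
      ((haarConv f f (diagPhase s * U) : ℝ) : ℂ) := by
  have e2 : (s : ℂ) / 2 = ((s / 2 : ℝ) : ℂ) := by push_cast; ring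
  simp only [e2, hB]
  rw [show diagPhase s = diagPhase (s / 2) * diagPhase (s / 2) by rw [← diagPhase_add]; ring_nf,
    haarConv_sq_mul hc f (diagPhase (s / 2)) U]
  simp only [mul_assoc, ← integral_complex_ofReal, Complex.ofReal_mul]

/-- **The denominator of (3.9) on the real slice**: if `B(w, s) = f(e^{−isσ₃}w)` for real `s` with `f` symmetric,
then `∫dv [B(v, 0)]² = ∫[f(v)]² dv = (f ⋆ f)(e₀)` ((5.3)). [cite: MullerSchiemann1987, (3.9) p.268, (5.3) p.275] -/
theorem normsq_real_slice {B : (Matrix.specialUnitaryGroup (Fin 2) ℂ) → ℂ → ℂ}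
    {f : (Matrix.specialUnitaryGroup (Fin 2) ℂ) → ℝ}
    (hB : ∀ (W : (Matrix.specialUnitaryGroup (Fin 2) ℂ)) (s : ℝ), B W (s : ℂ) = (f (diagPhase s * W) : ℂ))
    (hs : IsSymm f) :
    ∫ V, B V 0 ^ 2 ∂(haarProbability (Matrix.specialUnitaryGroup (Fin 2) ℂ)) = ((haarConv f f 1 : ℝ) : ℂ) := by
  have h0 : ∀ V : (Matrix.specialUnitaryGroup (Fin 2) ℂ), B V 0 = (f V : ℂ) := fun V => by
    rw [← Complex.ofReal_zero, hB V 0, diagPhase_zero, one_mul]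
  simp only [h0, haarConv_self_apply_one hs, ← integral_complex_ofReal, Complex.ofReal_pow]

/-- **(3.9) on the real slice**: `[𝒯₍₂₎B]^{1/2}(w, s) = [𝒯₂f]^{1/2}(e^{−isσ₃}w)` for real `s`, when
`B(w, s) = f(e^{−isσ₃}w)` with `f` central and symmetric — the continued `[𝒯₍₂₎·]^{1/2}` has again a real slice of
the form (2.6), with the group-level `[𝒯₂f]^{1/2} = (f ⋆ f)/(f ⋆ f)(e₀)`. [cite: MullerSchiemann1987, (3.9) p.268,
(2.6) p.264] -/
theorem sqrtT2_real_slice {B : (Matrix.specialUnitaryGroup (Fin 2) ℂ) → ℂ → ℂ}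
    {f : (Matrix.specialUnitaryGroup (Fin 2) ℂ) → ℝ}
    (hB : ∀ (W : (Matrix.specialUnitaryGroup (Fin 2) ℂ)) (s : ℝ), B W (s : ℂ) = (f (diagPhase s * W) : ℂ))
    (hc : IsCentral f) (hs : IsSymm f) (W : (Matrix.specialUnitaryGroup (Fin 2) ℂ)) (s : ℝ) :
    (∫ V, B (W * V⁻¹) ((s : ℂ) / 2) * B V ((s : ℂ) / 2) ∂(haarProbability (Matrix.specialUnitaryGroup (Fin 2) ℂ))) /
        ∫ V, B V 0 ^ 2 ∂(haarProbability (Matrix.specialUnitaryGroup (Fin 2) ℂ)) =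
      (((fun u => haarConv f f u / haarConv f f 1) (diagPhase s * W) : ℝ) : ℂ) := by
  rw [conv_real_slice hB hc W s, normsq_real_slice hB hs]
  push_cast
  rfl

/-- **(3.10) on the real slice is (2.4)**: `(𝒯₍₂₎B)(u, t) = {[𝒯₍₂₎B]^{1/2}(u, t)}² = 𝒯₂f(e^{−itσ₃}u)` for real
`t`, when `B(w, s) = f(e^{−isσ₃}w)` with `f` central and symmetric. [cite: MullerSchiemann1987, (3.10) p.268, (2.4)
p.263] -/
theorem T2_real_slice {B : (Matrix.specialUnitaryGroup (Fin 2) ℂ) → ℂ → ℂ}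
    {f : (Matrix.specialUnitaryGroup (Fin 2) ℂ) → ℝ}
    (hB : ∀ (W : (Matrix.specialUnitaryGroup (Fin 2) ℂ)) (s : ℝ), B W (s : ℂ) = (f (diagPhase s * W) : ℂ))
    (hc : IsCentral f) (hs : IsSymm f) (U : (Matrix.specialUnitaryGroup (Fin 2) ℂ)) (t : ℝ) :
    ((∫ V, B (U * V⁻¹) ((t : ℂ) / 2) * B V ((t : ℂ) / 2) ∂(haarProbability (Matrix.specialUnitaryGroup (Fin 2) ℂ))) /
        ∫ V, B V 0 ^ 2 ∂(haarProbability (Matrix.specialUnitaryGroup (Fin 2) ℂ))) ^ 2 =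
      ((migdal 2 f (diagPhase t * U) : ℝ) : ℂ) := by
  rw [sqrtT2_real_slice hB hc hs U t, migdal_two]
  push_cast
  rfl

/-! ## §3 (3.11) for the analytically continued transforms on `SU(2)`: `𝒯₍₄₎g̃ = {𝒯₍₂₎[𝒯₍₂₎g̃]^{1/2}}²` on the strip
`{|Im z| < 4d}` -/

/-- **(3.11) FOR THE CONTINUED TRANSFORMS** on `SU(2)`: let `g = H(u₀) ∈ 𝒢` with `H` holomorphic on the ellipse
`𝒟(d)`, `d > 0`, and `g̃_H(w, ζ) = H(u₀(w) cos ζ + u₃(w) sin ζ)` its extension (6.21) (holomorphic in `ζ` on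
`{|Im ζ| < d}`, jointly continuous). Then on the strip `{|Im z| < 4d}` the continued (3.8)
`(𝒯₍₄₎g̃_H)(u, z) = {∫dv₁ g̃_H(uv₁⁻¹, z/4) ∫dv₂ g̃_H(v₁v₂⁻¹, z/4) ∫dv₃ g̃_H(v₂v₃⁻¹, z/4) g̃_H(v₃, z/4)/g^{*4}(e₀)}⁴`
EQUALS `{𝒯₍₂₎[𝒯₍₂₎g̃_H]^{1/2}}²(u, z) = {(∫dv K(uv⁻¹, z/2) K(v, z/2)/∫dv[K(v,0)]²)²}²` with (3.9)'s
`K(w, ζ) = [𝒯₍₂₎g̃_H]^{1/2}(w, ζ) = ∫dv g̃_H(wv⁻¹, ζ/2) g̃_H(v, ζ/2)/∫dv[g̃_H(v, 0)]²`: both sides are holomorphic on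
the strip and they agree for real `z` by (3.11) on the group (§1) and the real slices (§2).
[cite: MullerSchiemann1987, (3.9)–(3.11) p.268, (3.8) p.267] -/
theorem eq311_continued {d : ℝ} (hd : 0 < d) {H : ℂ → ℂ} {g : (Matrix.specialUnitaryGroup (Fin 2) ℂ) → ℝ}
    (hH : DifferentiableOn ℂ H {w : ℂ | w.re ^ 2 / Real.cosh d ^ 2 + w.im ^ 2 / Real.sinh d ^ 2 < 1})
    (hg : ∀ U, (g U : ℂ) = H (u0 U)) (hG : InG g) (U : (Matrix.specialUnitaryGroup (Fin 2) ℂ)) :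
    EqOn
      (fun z : ℂ => ((∫ V₁, H ((u0 (U * V₁⁻¹) : ℂ) * Complex.cos (z / 4) + (u3 (U * V₁⁻¹) : ℂ) * Complex.sin (z / 4)) *
          ∫ V₂, H ((u0 (V₁ * V₂⁻¹) : ℂ) * Complex.cos (z / 4) + (u3 (V₁ * V₂⁻¹) : ℂ) * Complex.sin (z / 4)) *
            ∫ V₃, H ((u0 (V₂ * V₃⁻¹) : ℂ) * Complex.cos (z / 4) + (u3 (V₂ * V₃⁻¹) : ℂ) * Complex.sin (z / 4)) *
              H ((u0 V₃ : ℂ) * Complex.cos (z / 4) + (u3 V₃ : ℂ) * Complex.sin (z / 4))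
            ∂(haarProbability (Matrix.specialUnitaryGroup (Fin 2) ℂ))
            ∂(haarProbability (Matrix.specialUnitaryGroup (Fin 2) ℂ))
          ∂(haarProbability (Matrix.specialUnitaryGroup (Fin 2) ℂ))) /
          ((convPow g 3 1 : ℝ) : ℂ)) ^ 4)
      (fun z : ℂ => (((∫ V,
          ((∫ V', H ((u0 (U * V⁻¹ * V'⁻¹) : ℂ) * Complex.cos (z / 2 / 2) + (u3 (U * V⁻¹ * V'⁻¹) : ℂ) * Complex.sin (z / 2 / 2)) *
              H ((u0 V' : ℂ) * Complex.cos (z / 2 / 2) + (u3 V' : ℂ) * Complex.sin (z / 2 / 2))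
              ∂(haarProbability (Matrix.specialUnitaryGroup (Fin 2) ℂ))) /
            ∫ V', H ((u0 V' : ℂ) * Complex.cos 0 + (u3 V' : ℂ) * Complex.sin 0) ^ 2
              ∂(haarProbability (Matrix.specialUnitaryGroup (Fin 2) ℂ))) *
          ((∫ V', H ((u0 (V * V'⁻¹) : ℂ) * Complex.cos (z / 2 / 2) + (u3 (V * V'⁻¹) : ℂ) * Complex.sin (z / 2 / 2)) *
              H ((u0 V' : ℂ) * Complex.cos (z / 2 / 2) + (u3 V' : ℂ) * Complex.sin (z / 2 / 2))
              ∂(haarProbability (Matrix.specialUnitaryGroup (Fin 2) ℂ))) /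
            ∫ V', H ((u0 V' : ℂ) * Complex.cos 0 + (u3 V' : ℂ) * Complex.sin 0) ^ 2
              ∂(haarProbability (Matrix.specialUnitaryGroup (Fin 2) ℂ)))
          ∂(haarProbability (Matrix.specialUnitaryGroup (Fin 2) ℂ))) /
          ∫ V, ((∫ V', H ((u0 (V * V'⁻¹) : ℂ) * Complex.cos (0 / 2) + (u3 (V * V'⁻¹) : ℂ) * Complex.sin (0 / 2)) *
              H ((u0 V' : ℂ) * Complex.cos (0 / 2) + (u3 V' : ℂ) * Complex.sin (0 / 2))
              ∂(haarProbability (Matrix.specialUnitaryGroup (Fin 2) ℂ))) /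
            ∫ V', H ((u0 V' : ℂ) * Complex.cos 0 + (u3 V' : ℂ) * Complex.sin 0) ^ 2
              ∂(haarProbability (Matrix.specialUnitaryGroup (Fin 2) ℂ))) ^ 2
            ∂(haarProbability (Matrix.specialUnitaryGroup (Fin 2) ℂ))) ^ 2) ^ 2)
      {z : ℂ | |z.im| < 4 * d} := by
  -- `SU(2) ⊆ M₂(ℂ)` is first countable (dominated-convergence continuity of the continued convolutions)
  haveI : FirstCountableTopology (Matrix (Fin 2) (Fin 2) ℂ) :=
    inferInstanceAs (FirstCountableTopology (Fin 2 → Fin 2 → ℂ))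
  haveI : FirstCountableTopology (Matrix.specialUnitaryGroup (Fin 2) ℂ) :=
    Topology.IsInducing.subtypeVal.firstCountableTopology
  have h4d : 0 < 4 * d := by linarith
  have hc : IsCentral g := hG.central
  have hs : IsSymm g := isSymm_of_eq_H_u0 hg
  -- the extension `g̃_H` in the format of the siblings' continued-convolution lemmas
  set B : (Matrix.specialUnitaryGroup (Fin 2) ℂ) → ℂ → ℂ := fun W w =>
    H ((u0 W : ℂ) * Complex.cos w + (u3 W : ℂ) * Complex.sin w) with hBdef
  have hcont : ContinuousOn (uncurry B) (univ ×ˢ {z : ℂ | |z.im| < d}) := by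
    have := continuousOn_eq621 hH.continuousOn
    rw [show (univ ×ˢ {z : ℂ | |z.im| < d} : Set ((Matrix.specialUnitaryGroup (Fin 2) ℂ) × ℂ)) =
      {p | |p.2.im| < d} by ext p; simp]
    exact this
  have hhol : ∀ W : (Matrix.specialUnitaryGroup (Fin 2) ℂ), DifferentiableOn ℂ (B W) {z : ℂ | |z.im| < d} :=
    fun W => differentiableOn_eq621 hH W
  have hBreal : ∀ (W : (Matrix.specialUnitaryGroup (Fin 2) ℂ)) (s : ℝ), B W (s : ℂ) = (g (diagPhase s * W) : ℂ) :=
    fun W s => eq621_real_slice hg W s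
  -- (3.9): `K = [𝒯₍₂₎ g̃_H]^{1/2}`, jointly continuous and holomorphic on the strip `{|Im ζ| < 2d}`
  set M : ℂ := ∫ V', B V' 0 ^ 2 ∂(haarProbability (Matrix.specialUnitaryGroup (Fin 2) ℂ)) with hMdef
  set K : (Matrix.specialUnitaryGroup (Fin 2) ℂ) → ℂ → ℂ := fun W ζ =>
    (∫ V', B (W * V'⁻¹) (ζ / 2) * B V' (ζ / 2) ∂(haarProbability (Matrix.specialUnitaryGroup (Fin 2) ℂ))) / M
    with hKdef
  have hKcont : ContinuousOn (uncurry K) (univ ×ˢ {z : ℂ | |z.im| < 2 * d}) := (continuousOn_J hcont).div_const M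
  have hKhol : ∀ W : (Matrix.specialUnitaryGroup (Fin 2) ℂ), DifferentiableOn ℂ (K W) {z : ℂ | |z.im| < 2 * d} :=
    fun W => (differentiableOn_J hcont hhol W).div_const M
  -- the real slice of `K` is `[𝒯₂ g]^{1/2} = (g ⋆ g)/(g ⋆ g)(e₀)` ((3.9) at a real angle)
  have hKreal : ∀ (W : (Matrix.specialUnitaryGroup (Fin 2) ℂ)) (s : ℝ),
      K W (s : ℂ) = (((fun u => haarConv g g u / haarConv g g 1) (diagPhase s * W) : ℝ) : ℂ) :=
    fun W s => sqrtT2_real_slice hBreal hc hs W s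
  have hkc : IsCentral (fun u => haarConv g g u / haarConv g g 1) := isCentral_sqrtT2 hc
  have hks : IsSymm (fun u => haarConv g g u / haarConv g g 1) := isSymm_sqrtT2 hc hs
  -- both sides are holomorphic on `{|Im z| < 4d}`
  have hL : DifferentiableOn ℂ (fun z : ℂ => ((∫ V₁, B (U * V₁⁻¹) (z / 4) * ∫ V₂, B (V₁ * V₂⁻¹) (z / 4) *
      ∫ V₃, B (V₂ * V₃⁻¹) (z / 4) * B V₃ (z / 4) ∂(haarProbability (Matrix.specialUnitaryGroup (Fin 2) ℂ))
      ∂(haarProbability (Matrix.specialUnitaryGroup (Fin 2) ℂ)) ∂(haarProbability (Matrix.specialUnitaryGroup (Fin 2) ℂ))) /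
      ((convPow g 3 1 : ℝ) : ℂ)) ^ 4) {z : ℂ | |z.im| < 4 * d} :=
    differentiableOn_eq38 hcont hhol _ U
  have hR : DifferentiableOn ℂ (fun z : ℂ => (((∫ V, K (U * V⁻¹) (z / 2) * K V (z / 2)
      ∂(haarProbability (Matrix.specialUnitaryGroup (Fin 2) ℂ))) /
      ∫ V, K V 0 ^ 2 ∂(haarProbability (Matrix.specialUnitaryGroup (Fin 2) ℂ))) ^ 2) ^ 2) {z : ℂ | |z.im| < 4 * d} := by
    have h := (differentiableOn_eq31 hKcont hKhol
      (∫ V, K V 0 ^ 2 ∂(haarProbability (Matrix.specialUnitaryGroup (Fin 2) ℂ))) U).pow 2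
    exact h.mono fun z (hz : |z.im| < 4 * d) => show |z.im| < 2 * (2 * d) by linarith
  refine (eqOn_setOf_abs_im_lt_of_forall_ofReal h4d hL hR fun t => ?_)
  -- the real identity: (3.11) on the group between the real slices
  show ((∫ V₁, B (U * V₁⁻¹) ((t : ℂ) / 4) * ∫ V₂, B (V₁ * V₂⁻¹) ((t : ℂ) / 4) *
      ∫ V₃, B (V₂ * V₃⁻¹) ((t : ℂ) / 4) * B V₃ ((t : ℂ) / 4) ∂(haarProbability (Matrix.specialUnitaryGroup (Fin 2) ℂ))
      ∂(haarProbability (Matrix.specialUnitaryGroup (Fin 2) ℂ)) ∂(haarProbability (Matrix.specialUnitaryGroup (Fin 2) ℂ))) /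
      ((convPow g 3 1 : ℝ) : ℂ)) ^ 4 =
    (((∫ V, K (U * V⁻¹) ((t : ℂ) / 2) * K V ((t : ℂ) / 2) ∂(haarProbability (Matrix.specialUnitaryGroup (Fin 2) ℂ))) /
      ∫ V, K V 0 ^ 2 ∂(haarProbability (Matrix.specialUnitaryGroup (Fin 2) ℂ))) ^ 2) ^ 2
  rw [T2_real_slice hKreal hkc hks U t, hBdef, brace38_real_slice hg hc U t, ← Complex.ofReal_pow,
    ← eq311 hG.continuous (convPow_apply_one_pos hG 1).ne', migdal_four]
  push_cast
  rfl

end ReductionT4T2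

end MullerSchiemann1987

end Literature.MathematicalPhysics.QuantumFieldTheory
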